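/-
Copyright (c) 2026 the pub-hodgecm-mathlib formalisation cell (harness21).  Prover seat hodgecm-mathlib-LH4-p14 (g8) (L1 valve hand; (P-dec) writer per the K1b∕ρ desk's
handoff 2026-09-05T00:32Z), Track B «K2-LIT» ∕ hLiu418 #184♮, socket #41 KIND 1, package (K1b-♮), letter (P-dec) ∕ (dec-0):
FRAME INDEPENDENCE — the rank-one line Whittaker value does not depend on the row section `γ` nor on the transported index `S'`.  THEOREMS ONLY.
-/
import Summits.HodgeConjecture.HodgeConjecture.Theorems.K2LiuKindOneLinePin                         -- ★ p863230∕p863263: the pin frame (imports ★ p862785, ★ `…_inl`, ★ p862749, …)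
import Summits.HodgeConjecture.HodgeConjecture.Theorems.K2LiuEisensteinContinuationGlue            -- ★ `eqOn_of_eqOn_halfPlane` (identity theorem on a half-plane)
import HarnessLib

/-!
# Crux `HLiu418`, socket #41, KIND 1 — (P-dec) letter (dec-0) `K2LiuKindOneLineFrameIndependence`: THE LINE WHITTAKER VALUE IS INDEPENDENT OF `γ` AND `S'`

Cell `hodgecm-mathlib`, crux item hLiu418 = `stmt-HodgeConjecture-24832` (helper lane `--supports … --as helper`, count-neutral), route of record `HCCMUnconditional`;
squad K2 ∕ K2Liu, road `K2_Liu`, socket #41, KIND 1, package (K1b-♮): OF-RECORD assembly ★ p863630 `exists_kindOne_lineTerm_of_record` leaves BY VALUE the decay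
letters `hWdec1 ∕ hWdec0`, quantified over EVERY frame, EVERY row section `γ` and EVERY transported index `S'` with the re-indexing letter `hψ`, with constants uniform
in the index `S`.  Read directly through the fine majorant of the corner-translate family this generality is not provable (the height of `Λγ[w]` and `|σ♭|⁻¹` are
uncontrolled in `S` for a pathological section); it is TRUE for a structural reason, which THIS FILE proves: ★ p862785 `exists_middle_cell_rankOne_eq_whittakerDelta_line`
fixes ONE constant `C ∈ (0, ∞)` BEFORE `γ, S'` and identifies, for every `(γ, S')`, `MID_S(νN, β, f_s, x) = C • W⁽ᴮ⁾_{S'₂₂}(nB_* μ)(y ↦ f_s(blkD(1,y) · Λγ[w] · x))(1)` on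
`{1 < re s}`; the left side does not mention `(γ, S')`, so two frames give the SAME Whittaker value on `{1 < re s}`, hence on the whole window `{0 < re s}` by holomorphy
(★ p862749, §2 of ★ p863263 for the `inl` chart) and the identity theorem on the half-plane (★ `eqOn_of_eqOn_halfPlane`).
* **`whittakerDelta_line_eq_of_rowSections`** (`e (1,0) = 1`) — socket prefix + the frame `(eA eB dA dB, Λ, μ, nB)` BY VALUE ⊢ for all row sections `γ₁ γ₂`, every
  rank-one `S = u ⊗ w` and transported indices `S'₁` (w.r.t. `γ₁`), `S'₂` (w.r.t. `γ₂`), every `s` with `0 < re s` and every `x`: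
  `W⁽ᴮ⁾(nB_*μ)((σS'₁σ⁻¹)₂₂)(y ↦ f_s(blkD(1,y) · Λγ₁[w] · x))(1) = W⁽ᴮ⁾(nB_*μ)((σS'₂σ⁻¹)₂₂)(y ↦ f_s(blkD(1,y) · Λγ₂[w] · x))(1)`.
* **`whittakerDelta_line_eq_of_rowSections_inl`** (`e (1,0) = 0`) — the token-for-token twin along the first summand.
USE ((P-dec) head): prove the `D`-polynomial decay at the NORMALISED section `γ₀` (★ p863259 ∕ p863374) with `S' := σ♭ E₁₁` (★ `conj_index_eq_single`) and move it to
the letter's arbitrary `(γ, S')` by this file — same constants.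
HONEST LABEL.  Count-neutral helper; closes no socket: `HC_CM` is proved only modulo the 7 printed citations (2 remaining named inputs: hLiu418 =
`stmt-HodgeConjecture-24832`, h413 = `stmt-HodgeConjecture-24833`) until rung 0 closes.

## References
* [KudlaRallis1994] S. Kudla, S. Rallis, Ann. of Math. 140 (1994): §2 (2.10)–(2.12).
* [MoeglinWaldspurger1995] C. Mœglin, J.-L. Waldspurger, *Spectral decomposition and Eisenstein series* (1995): II.1.7, IV.1.9 (identity theorem on the half-plane).
* [Conway1978] J. B. Conway, *Functions of One Complex Variable I*: IV.3 (identity theorem).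
-/

set_option autoImplicit false
-- the mandated namespace repeats the single-problem summit's segment (`HodgeConjecture.HodgeConjecture`)
set_option linter.dupNamespace false

noncomputable section

open scoped Matrix ENNReal NNReal Topology ComplexConjugate
open NumberField IsDedekindDomain MeasureTheory MeasureTheory.Measure Filter Set Function
open Literature.NumberTheory.Automorphic Literature.NumberTheory.Automorphic.UnitaryGroup Literature.NumberTheory.GaloisRepresentations
open Literature.NumberTheory.GelbartRogawski1991 Literature.NumberTheory.GelbartRogawski1991.GRConstruction
open Literature.NumberTheory.GelbartRogawski1991.AdaptedBlocks
open Literature.NumberTheory.K2Lit.SiegelDoubled Literature.MeasureTheory.Group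
open Literature.NumberTheory.Automorphic.IdeleClassGroup
open UnitaryDualPair

namespace Summit.HodgeConjecture.HodgeConjecture.Cruxes.HLiu418.K2LiuKindOneLineFrameIndependence

open K2LiuSiegelUnipotentFourierDefs K2LiuSiegelUnipotentCharacters K2LiuUnipotentCoveringWeight K2LiuSiegelFourierCoeffDelta
open K2LiuSiegelRationalLeviDecomposition K2LiuSiegelMiddleCellSortedPattern K2LiuSiegelMiddleCellLeviCriterion K2LiuSiegelBruhatMiddleCellDelta
open K2LiuRankOneMiddleTermWhittakerLine (exists_middle_cell_rankOne_eq_whittakerDelta_line)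
open K2LiuRankOneMiddleTermWhittakerLineInl (exists_middle_cell_rankOne_eq_whittakerDelta_line_inl)
open K2LiuKindOneLineWhittakerHolomorphyCorner (differentiableOn_whittakerDelta_cornerTranslate_line)
open K2LiuKindOneLinePin (differentiableOn_whittakerDelta_blkD_inl_line)
open K2LiuLineCornerChartHaar (isHaarMeasure_map_lineChart)
open K2LiuUnipDeltaConjMeasurePreserving (measurePreserving_conj_levi)
open K2LiuSiegelMiddleTermStabilizerWeight (exists_stabilizer_coveringWeight)
open K2LiuSiegelEisensteinConstantTermFiniteness (lintegral_tsum_enorm_mul_weight_ne_top)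
open K2LiuEisensteinContinuationGlue (eqOn_of_eqOn_halfPlane)

/-- two complex numbers with the same non-zero real multiple are equal. [folklore] -/
theorem eq_of_real_smul_eq {c : ℝ} (hc : c ≠ 0) {z₁ z₂ : ℂ} (h : c • z₁ = c • z₂) : z₁ = z₂ :=
  smul_right_injective ℂ hc h

/-- the identity theorem in the shape used here: two functions holomorphic on `{0 < re s}` that agree on `{1 < re s}` agree on `{0 < re s}` (★ `eqOn_of_eqOn_halfPlane`
with the irrelevant puncture at `s₀ = −1`). [cite: Conway1978, IV.3] [cite: MoeglinWaldspurger1995, IV.1.9] -/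
theorem eq_of_eq_on_one_lt {E₁ E₂ : ℂ → ℂ} (h₁ : DifferentiableOn ℂ E₁ {s : ℂ | 0 < s.re}) (h₂ : DifferentiableOn ℂ E₂ {s : ℂ | 0 < s.re})
    (heq : ∀ s : ℂ, 1 < s.re → E₁ s = E₂ s) {s : ℂ} (hs : 0 < s.re) : E₁ s = E₂ s := by
  have h := eqOn_of_eqOn_halfPlane (E₁ := E₁) (E₂ := E₂) (a := 0) (c := 1) (s₀ := (-1 : ℂ)) zero_le_one
    (h₁.mono Set.sdiff_subset) (h₂.mono Set.sdiff_subset) heq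
  refine h ⟨hs, fun hmem => ?_⟩
  rw [Set.mem_singleton_iff] at hmem
  rw [hmem] at hs
  norm_num at hs

/-- **(dec-0) FRAME INDEPENDENCE OF THE LINE WHITTAKER VALUE** (corner enumeration `e (1,0) = 1`).  Socket prefix of #41 at `n = 2` + the frame `(eA eB dA dB, Λ, μ, nB)` BY VALUE;
then for ANY two row sections `γ₁, γ₂`, a rank-one `T_L`-skew `S = u ⊗ w` and transported indices `S'₁` (w.r.t. `Λγ₁[w]`), `S'₂` (w.r.t. `Λγ₂[w]`), every `s` on the window
`{0 < re s}` and every point `x`: the two rank-one line Whittaker values COINCIDE.  (★ p862785 pins both to `C⁻¹ • MID_S(νN, β, f_s, x)` on `{1 < re s}` with ONE `C`;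
★ p862749 + ★ `eqOn_of_eqOn_halfPlane` continue the equality to the window.)
[cite: KudlaRallis1994, §2 (2.10)–(2.12)] [cite: MoeglinWaldspurger1995, II.1.7, IV.1.9] [cite: Conway1978, IV.3] -/
theorem whittakerDelta_line_eq_of_rowSections
    (L : Type) [Field L] [NumberField L] [IsCMField L] (e : Fin 2 × Fin 1 ≃ Fin 2)
    (dV : Fin 2 → L) (hdV : ∀ i, IsCMField.complexConj L (dV i) = dV i) (hdV0 : ∀ i, dV i ≠ 0)
    (dW : Fin 1 → L) (hdW : ∀ i, IsCMField.complexConj L (dW i) = dW i) (hdW0 : ∀ i, dW i ≠ 0)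
    (lam : IdeleClassGroup L →ₜ* Circle) (_hlam : IsConjugateSymplectic L lam) (_hw : HasWeight L lam 1)
    (𝒦 : IwasawaDatum L e dV hdV dW hdW) (_h𝒦 : 𝒦.IsStd) (f : ℂ → HA L e dV hdV dW hdW → ℂ)
    (hstd : IsStandardSectionFamily 𝒦 (toHeckeCharacter L lam⁻¹) f) (hcont : ∀ s, Continuous (f s))
    [MeasurableSpace (unipDelta L e dV hdV dW hdW)] [BorelSpace (unipDelta L e dV hdV dW hdW)]
    (νN : Measure (unipDelta L e dV hdV dW hdW)) [νN.IsHaarMeasure]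
    (β : unipDelta L e dV hdV dW hdW → ℝ≥0∞) (hβ : IsCoveringWeight (unipDeltaRat L e dV hdV dW hdW) β)
    (_hβ0 : ∫⁻ u, β u ∂νN ≠ 0) (hβtop : ∫⁻ u, β u ∂νN ≠ ∞)
    {K : Set (unipDelta L e dV hdV dW hdW)} (hK : IsCompact K) (hβK : ∀ u, β u ≤ K.indicator 1 u)
    (wq : unipDeltaRat L e dV hdV dW hdW → ratH L e dV hdV dW hdW)
    (hwq : ∀ ν, ((wq ν : ratH L e dV hdV dW hdW) : HA L e dV hdV dW hdW) = weylDelta L e dV hdV dW hdW * ((ν : unipDelta L e dV hdV dW hdW) : HA L e dV hdV dW hdW))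
    -- the corner enumeration (the `e (1, 0) = 0` enumeration is the `inl` twin ★ `K2LiuRankOneMiddleTermWhittakerLineInl`)
    (he : e (1, 0) = 1)
    -- the see-saw datum `V = A ⊕ B` BY VALUE (the writer takes `eA = eB` the unique equivalence, `dA _ := dV 0`, `dB _ := dV 1`, `borel` instances)
    {n₁ n₂ : ℕ} (eA : Fin 1 × Fin 1 ≃ Fin n₁) (eB : Fin 1 × Fin 1 ≃ Fin n₂)
    (dA : Fin 1 → L) (hdA : ∀ i, IsCMField.complexConj L (dA i) = dA i)
    (dB : Fin 1 → L) (hdB : ∀ i, IsCMField.complexConj L (dB i) = dB i) (hdB0 : ∀ i, dB i ≠ 0)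
    (hVA : ∀ i, dV (Fin.castAdd 1 i) = dA i) (hVB : ∀ j, dV (Fin.natAdd 1 j) = dB j)
    [MeasurableSpace (unipDelta L eB dB hdB dW hdW)] [BorelSpace (unipDelta L eB dB hdB dW hdW)]
    -- the Levi chart BY VALUE (★ `exists_leviHom`)
    (Λ : GL (Fin 2) (AdeleRing (𝓞 L) L) →* HA L e dV hdV dW hdW)
    (hΛ : ∀ g : GL (Fin 2) (AdeleRing (𝓞 L) L), blk L e dV hdV dW hdW (Λ g) =
      cayR (AdeleRing (𝓞 L) L) (Fin 2) * Matrix.fromBlocks (g : Matrix (Fin 2) (Fin 2) (AdeleRing (𝓞 L) L)) 0 0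
        (((gramR L e dV hdV dW hdW).map ((algebraMap L (AdeleRing (𝓞 L) L)).comp (algebraMap (Fp L) L)))⁻¹ *
          (((g⁻¹ : GL (Fin 2) (AdeleRing (𝓞 L) L)) : Matrix (Fin 2) (Fin 2) (AdeleRing (𝓞 L) L)).map
            (conjAdele (Fp L) L (IsCMField.complexConj L)))ᵀ *
          (gramR L e dV hdV dW hdW).map ((algebraMap L (AdeleRing (𝓞 L) L)).comp (algebraMap (Fp L) L))) *
        cayRinv (AdeleRing (𝓞 L) L) (Fin 2))
    -- the additive Haar measure on `𝔸_{L⁺}` and the line chart of `H(B)` BY VALUE (★ p862662 `exists_lineChart`)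
    [MeasurableSpace (AdeleRing (𝓞 (Fp L)) (Fp L))] [BorelSpace (AdeleRing (𝓞 (Fp L)) (Fp L))]
    (μ : Measure (AdeleRing (𝓞 (Fp L)) (Fp L))) [μ.IsAddHaarMeasure]
    (nB : AdeleRing (𝓞 (Fp L)) (Fp L) → unipDelta L eB dB hdB dW hdW) (hnBc : Continuous nB) (hnBadd : ∀ s t, nB (s + t) = nB s * nB t)
    (hnB : ∀ t, (blk L eB dB hdB dW hdW (nB t : HA L eB dB hdB dW hdW)).toBlocks₁₂ =
      Matrix.of fun _ _ => AdeleRing.baseChange (Fp L) L t * algebraMap L (AdeleRing (𝓞 L) L) (imagUnit L))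
    -- TWO row sections BY VALUE
    (γ₁ : Projectivization L (Fin 2 → L) → GL (Fin 2) L)
    (hγ₁ : ∀ p, Projectivization.mk L ((γ₁ p : Matrix (Fin 2) (Fin 2) L) 1) (row_ne_zero (γ₁ p) 1) = p)
    (γ₂ : Projectivization L (Fin 2 → L) → GL (Fin 2) L)
    (hγ₂ : ∀ p, Projectivization.mk L ((γ₂ p : Matrix (Fin 2) (Fin 2) L) 1) (row_ne_zero (γ₂ p) 1) = p)
    -- one rank-one index, two transported indices
    (S : skewMatrices ((IsCMField.complexConj L : L ≃ₐ[Fp L] L) : L →+* L) ((gramR L e dV hdV dW hdW).map (algebraMap (Fp L) L)))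
    {u w : Fin 2 → L} (hS1 : (S : Matrix (Fin 2) (Fin 2) L) = Matrix.vecMulVec u w) (hu : u ≠ 0) (hw : w ≠ 0)
    (S'₁ : Matrix (Fin 2) (Fin 2) L)
    (hψ₁ : ∀ v : HA L e dV hdV dW hdW, v ∈ unipDelta L e dV hdV dW hdW →
      unipDeltaChar L e dV hdV dW hdW (S : Matrix (Fin 2) (Fin 2) L)
          ((Λ (Matrix.GeneralLinearGroup.map (algebraMap L (AdeleRing (𝓞 L) L)) (γ₁ (Projectivization.mk L w hw))))⁻¹ * v *
            Λ (Matrix.GeneralLinearGroup.map (algebraMap L (AdeleRing (𝓞 L) L)) (γ₁ (Projectivization.mk L w hw)))) =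
        unipDeltaChar L e dV hdV dW hdW S'₁ v)
    (S'₂ : Matrix (Fin 2) (Fin 2) L)
    (hψ₂ : ∀ v : HA L e dV hdV dW hdW, v ∈ unipDelta L e dV hdV dW hdW →
      unipDeltaChar L e dV hdV dW hdW (S : Matrix (Fin 2) (Fin 2) L)
          ((Λ (Matrix.GeneralLinearGroup.map (algebraMap L (AdeleRing (𝓞 L) L)) (γ₂ (Projectivization.mk L w hw))))⁻¹ * v *
            Λ (Matrix.GeneralLinearGroup.map (algebraMap L (AdeleRing (𝓞 L) L)) (γ₂ (Projectivization.mk L w hw)))) =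
        unipDeltaChar L e dV hdV dW hdW S'₂ v)
    {s : ℂ} (hs : 0 < s.re) (x : HA L e dV hdV dW hdW) :
    whittakerDelta L eB dB hdB dW hdW (Measure.map nB μ) ((Matrix.reindex (idxSplit e eA eB) (idxSplit e eA eB) S'₁).toBlocks₂₂)
        (fun y => f s (blkD L e eA eB dA hdA dB hdB dV hdV hVA hVB dW hdW (1, y) *
          (Λ (Matrix.GeneralLinearGroup.map (algebraMap L (AdeleRing (𝓞 L) L)) (γ₁ (Projectivization.mk L w hw))) * x))) 1 =
      whittakerDelta L eB dB hdB dW hdW (Measure.map nB μ) ((Matrix.reindex (idxSplit e eA eB) (idxSplit e eA eB) S'₂).toBlocks₂₂)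
        (fun y => f s (blkD L e eA eB dA hdA dB hdB dV hdV hVA hVB dW hdW (1, y) *
          (Λ (Matrix.GeneralLinearGroup.map (algebraMap L (AdeleRing (𝓞 L) L)) (γ₂ (Projectivization.mk L w hw))) * x))) 1 := by
  -- the TOP's character is unitary; the line datum has `n₁ = n₂`
  have hχ : (toHeckeCharacter L lam⁻¹).IsUnitary := isUnitary_toHeckeCharacter L lam⁻¹
  have hn : n₁ = n₂ := by
    have hA : Fintype.card (Fin 1 × Fin 1) = Fintype.card (Fin n₁) := Fintype.card_congr eA
    have hB : Fintype.card (Fin 1 × Fin 1) = Fintype.card (Fin n₂) := Fintype.card_congr eB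
    simp only [Fintype.card_prod, Fintype.card_fin] at hA hB
    omega
  -- the middle reflection, the stabiliser lattice with a covering weight, the Haar measure `nB_* μ`
  obtain ⟨g₀, hg₀, -⟩ := exists_reflStd L e dV dW
  obtain ⟨Γ₀, β₁, hΓ₀, hβ₁⟩ := exists_stabilizer_coveringWeight L e dV hdV dW hdW
    (⟨iotaGG L e dV hdV dW hdW (1, UnitaryGroup.rationalPairToAdelic (Fp L) L (IsCMField.complexConj L) 2 1 (Matrix.diagonal dV) (Matrix.diagonal dW) g₀),
      iotaGG_one_mem_ratH L e dV hdV dW hdW g₀⟩ : ratH L e dV hdV dW hdW)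
  haveI : (Measure.map nB μ).IsHaarMeasure := isHaarMeasure_map_lineChart L eB dB hdB dW hdW hdB0 hdW0 μ nB hnBc hnBadd hnB
  -- ★ p862785: ONE constant `C` BEFORE `γ, S'`
  have hmid := exists_middle_cell_rankOne_eq_whittakerDelta_line eA eB dA hdA dB hdB hVA hVB
    (hg₀ := hg₀) (Λ := Λ) (hΛ := hΛ) (Γ₀ := Γ₀) (hΓ₀ := hΓ₀) (wq := wq) (hwq := hwq) hdV0 hdW0 he νN μ nB hnBc hnB
  obtain ⟨C, hC0, hCtop, hmain⟩ := hmid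
  have hCr : C.toReal ≠ 0 := (ENNReal.toReal_pos hC0 hCtop).ne'
  -- the two Whittaker values as functions of `s`, holomorphic on the window (★ p862749 at `p₀ := 1`)
  have hhol : ∀ (γ : Projectivization L (Fin 2 → L) → GL (Fin 2) L) (S' : Matrix (Fin 2) (Fin 2) L), DifferentiableOn ℂ (fun s : ℂ =>
      whittakerDelta L eB dB hdB dW hdW (Measure.map nB μ) ((Matrix.reindex (idxSplit e eA eB) (idxSplit e eA eB) S').toBlocks₂₂)
        (fun y => f s (blkD L e eA eB dA hdA dB hdB dV hdV hVA hVB dW hdW (1, y) *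
          (Λ (Matrix.GeneralLinearGroup.map (algebraMap L (AdeleRing (𝓞 L) L)) (γ (Projectivization.mk L w hw))) * x))) 1) {s : ℂ | 0 < s.re} := by
    intro γ S'
    have h := differentiableOn_whittakerDelta_cornerTranslate_line (N₁ := 1) (N₂ := 1) (M := 1) (n := 2) L e eA eB dA hdA dB hdB dV hdV hVA hVB dW hdW
      hdB0 hdW0 hn (𝒦 := 𝒦) (χ := toHeckeCharacter L lam⁻¹) (f := f) hχ hstd hcont (p₀ := 1) (isSiegelDelta_one' L e dV hdV dW hdW)
      (Λ (Matrix.GeneralLinearGroup.map (algebraMap L (AdeleRing (𝓞 L) L)) (γ (Projectivization.mk L w hw))) * x) (Measure.map nB μ)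
      ((Matrix.reindex (idxSplit e eA eB) (idxSplit e eA eB) S').toBlocks₂₂) 1
    simp only [one_mul] at h
    exact h
  -- equality on `{1 < re s}` through the middle term, then on the window by the identity theorem
  refine eq_of_eq_on_one_lt (hhol γ₁ S'₁) (hhol γ₂ S'₂) (fun t ht => ?_) hs
  have ht' : ((2 : ℕ) : ℝ) / 2 < t.re := by norm_num; exact ht
  have hH := lintegral_tsum_enorm_mul_weight_ne_top L e dV hdV dW hdW hdV0 hdW0 hχ ht' (hstd.1.1 t) (hcont t) νN hβtop hK hβK x
  have k₁ := hmain hβ₁ hβ (hstd.1.1 t) (hcont t) (fun g => measurePreserving_conj_levi Λ hΛ hdV0 hdW0 νN g) S.2 hS1 hu hw γ₁ hγ₁ S'₁ hψ₁ x hH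
  have k₂ := hmain hβ₁ hβ (hstd.1.1 t) (hcont t) (fun g => measurePreserving_conj_levi Λ hΛ hdV0 hdW0 νN g) S.2 hS1 hu hw γ₂ hγ₂ S'₂ hψ₂ x hH
  exact eq_of_real_smul_eq hCr (k₁.symm.trans k₂)

/-- **(dec-0), `inl` ENUMERATION `e (1,0) = 0`** — the token-for-token twin of `whittakerDelta_line_eq_of_rowSections` along the FIRST summand (line chart and Haar measure on
`N_Δ^{(A)}(𝔸)`, index `(σS'σ⁻¹)₁₁`, inner section `y ↦ f_s(blkD(y,1) · Λγ[w] · x)`; ★ `exists_middle_cell_rankOne_eq_whittakerDelta_line_inl`, ★ p863263 §2).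
[cite: KudlaRallis1994, §2 (2.10)–(2.12)] [cite: MoeglinWaldspurger1995, II.1.7, IV.1.9] [cite: Conway1978, IV.3] -/
theorem whittakerDelta_line_eq_of_rowSections_inl
    (L : Type) [Field L] [NumberField L] [IsCMField L] (e : Fin 2 × Fin 1 ≃ Fin 2)
    (dV : Fin 2 → L) (hdV : ∀ i, IsCMField.complexConj L (dV i) = dV i) (hdV0 : ∀ i, dV i ≠ 0)
    (dW : Fin 1 → L) (hdW : ∀ i, IsCMField.complexConj L (dW i) = dW i) (hdW0 : ∀ i, dW i ≠ 0)
    (lam : IdeleClassGroup L →ₜ* Circle) (_hlam : IsConjugateSymplectic L lam) (_hw : HasWeight L lam 1)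
    (𝒦 : IwasawaDatum L e dV hdV dW hdW) (_h𝒦 : 𝒦.IsStd) (f : ℂ → HA L e dV hdV dW hdW → ℂ)
    (hstd : IsStandardSectionFamily 𝒦 (toHeckeCharacter L lam⁻¹) f) (hcont : ∀ s, Continuous (f s))
    [MeasurableSpace (unipDelta L e dV hdV dW hdW)] [BorelSpace (unipDelta L e dV hdV dW hdW)]
    (νN : Measure (unipDelta L e dV hdV dW hdW)) [νN.IsHaarMeasure]
    (β : unipDelta L e dV hdV dW hdW → ℝ≥0∞) (hβ : IsCoveringWeight (unipDeltaRat L e dV hdV dW hdW) β)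
    (_hβ0 : ∫⁻ u, β u ∂νN ≠ 0) (hβtop : ∫⁻ u, β u ∂νN ≠ ∞)
    {K : Set (unipDelta L e dV hdV dW hdW)} (hK : IsCompact K) (hβK : ∀ u, β u ≤ K.indicator 1 u)
    (wq : unipDeltaRat L e dV hdV dW hdW → ratH L e dV hdV dW hdW)
    (hwq : ∀ ν, ((wq ν : ratH L e dV hdV dW hdW) : HA L e dV hdV dW hdW) = weylDelta L e dV hdV dW hdW * ((ν : unipDelta L e dV hdV dW hdW) : HA L e dV hdV dW hdW))
    -- the `inl` enumeration
    (he : e (1, 0) = 0)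
    -- the see-saw datum `V = A ⊕ B` BY VALUE
    {n₁ n₂ : ℕ} (eA : Fin 1 × Fin 1 ≃ Fin n₁) (eB : Fin 1 × Fin 1 ≃ Fin n₂)
    (dA : Fin 1 → L) (hdA : ∀ i, IsCMField.complexConj L (dA i) = dA i) (hdA0 : ∀ i, dA i ≠ 0)
    (dB : Fin 1 → L) (hdB : ∀ i, IsCMField.complexConj L (dB i) = dB i)
    (hVA : ∀ i, dV (Fin.castAdd 1 i) = dA i) (hVB : ∀ j, dV (Fin.natAdd 1 j) = dB j)
    [MeasurableSpace (unipDelta L eA dA hdA dW hdW)] [BorelSpace (unipDelta L eA dA hdA dW hdW)]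
    -- the Levi chart BY VALUE (★ `exists_leviHom`)
    (Λ : GL (Fin 2) (AdeleRing (𝓞 L) L) →* HA L e dV hdV dW hdW)
    (hΛ : ∀ g : GL (Fin 2) (AdeleRing (𝓞 L) L), blk L e dV hdV dW hdW (Λ g) =
      cayR (AdeleRing (𝓞 L) L) (Fin 2) * Matrix.fromBlocks (g : Matrix (Fin 2) (Fin 2) (AdeleRing (𝓞 L) L)) 0 0
        (((gramR L e dV hdV dW hdW).map ((algebraMap L (AdeleRing (𝓞 L) L)).comp (algebraMap (Fp L) L)))⁻¹ *
          (((g⁻¹ : GL (Fin 2) (AdeleRing (𝓞 L) L)) : Matrix (Fin 2) (Fin 2) (AdeleRing (𝓞 L) L)).map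
            (conjAdele (Fp L) L (IsCMField.complexConj L)))ᵀ *
          (gramR L e dV hdV dW hdW).map ((algebraMap L (AdeleRing (𝓞 L) L)).comp (algebraMap (Fp L) L))) *
        cayRinv (AdeleRing (𝓞 L) L) (Fin 2))
    -- the additive Haar measure on `𝔸_{L⁺}` and the line chart of `H(A)` BY VALUE (★ p862662 `exists_lineChart` on the datum `eA dA`)
    [MeasurableSpace (AdeleRing (𝓞 (Fp L)) (Fp L))] [BorelSpace (AdeleRing (𝓞 (Fp L)) (Fp L))]
    (μ : Measure (AdeleRing (𝓞 (Fp L)) (Fp L))) [μ.IsAddHaarMeasure]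
    (nB : AdeleRing (𝓞 (Fp L)) (Fp L) → unipDelta L eA dA hdA dW hdW) (hnBc : Continuous nB) (hnBadd : ∀ s t, nB (s + t) = nB s * nB t)
    (hnB : ∀ t, (blk L eA dA hdA dW hdW (nB t : HA L eA dA hdA dW hdW)).toBlocks₁₂ =
      Matrix.of fun _ _ => AdeleRing.baseChange (Fp L) L t * algebraMap L (AdeleRing (𝓞 L) L) (imagUnit L))
    -- TWO row sections BY VALUE
    (γ₁ : Projectivization L (Fin 2 → L) → GL (Fin 2) L)
    (hγ₁ : ∀ p, Projectivization.mk L ((γ₁ p : Matrix (Fin 2) (Fin 2) L) 1) (row_ne_zero (γ₁ p) 1) = p)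
    (γ₂ : Projectivization L (Fin 2 → L) → GL (Fin 2) L)
    (hγ₂ : ∀ p, Projectivization.mk L ((γ₂ p : Matrix (Fin 2) (Fin 2) L) 1) (row_ne_zero (γ₂ p) 1) = p)
    -- one rank-one index, two transported indices
    (S : skewMatrices ((IsCMField.complexConj L : L ≃ₐ[Fp L] L) : L →+* L) ((gramR L e dV hdV dW hdW).map (algebraMap (Fp L) L)))
    {u w : Fin 2 → L} (hS1 : (S : Matrix (Fin 2) (Fin 2) L) = Matrix.vecMulVec u w) (hu : u ≠ 0) (hw : w ≠ 0)
    (S'₁ : Matrix (Fin 2) (Fin 2) L)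
    (hψ₁ : ∀ v : HA L e dV hdV dW hdW, v ∈ unipDelta L e dV hdV dW hdW →
      unipDeltaChar L e dV hdV dW hdW (S : Matrix (Fin 2) (Fin 2) L)
          ((Λ (Matrix.GeneralLinearGroup.map (algebraMap L (AdeleRing (𝓞 L) L)) (γ₁ (Projectivization.mk L w hw))))⁻¹ * v *
            Λ (Matrix.GeneralLinearGroup.map (algebraMap L (AdeleRing (𝓞 L) L)) (γ₁ (Projectivization.mk L w hw)))) =
        unipDeltaChar L e dV hdV dW hdW S'₁ v)
    (S'₂ : Matrix (Fin 2) (Fin 2) L)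
    (hψ₂ : ∀ v : HA L e dV hdV dW hdW, v ∈ unipDelta L e dV hdV dW hdW →
      unipDeltaChar L e dV hdV dW hdW (S : Matrix (Fin 2) (Fin 2) L)
          ((Λ (Matrix.GeneralLinearGroup.map (algebraMap L (AdeleRing (𝓞 L) L)) (γ₂ (Projectivization.mk L w hw))))⁻¹ * v *
            Λ (Matrix.GeneralLinearGroup.map (algebraMap L (AdeleRing (𝓞 L) L)) (γ₂ (Projectivization.mk L w hw)))) =
        unipDeltaChar L e dV hdV dW hdW S'₂ v)
    {s : ℂ} (hs : 0 < s.re) (x : HA L e dV hdV dW hdW) :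
    whittakerDelta L eA dA hdA dW hdW (Measure.map nB μ) ((Matrix.reindex (idxSplit e eA eB) (idxSplit e eA eB) S'₁).toBlocks₁₁)
        (fun y => f s (blkD L e eA eB dA hdA dB hdB dV hdV hVA hVB dW hdW (y, 1) *
          (Λ (Matrix.GeneralLinearGroup.map (algebraMap L (AdeleRing (𝓞 L) L)) (γ₁ (Projectivization.mk L w hw))) * x))) 1 =
      whittakerDelta L eA dA hdA dW hdW (Measure.map nB μ) ((Matrix.reindex (idxSplit e eA eB) (idxSplit e eA eB) S'₂).toBlocks₁₁)
        (fun y => f s (blkD L e eA eB dA hdA dB hdB dV hdV hVA hVB dW hdW (y, 1) *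
          (Λ (Matrix.GeneralLinearGroup.map (algebraMap L (AdeleRing (𝓞 L) L)) (γ₂ (Projectivization.mk L w hw))) * x))) 1 := by
  -- the TOP's character is unitary; the line datum has `n₁ = n₂`
  have hχ : (toHeckeCharacter L lam⁻¹).IsUnitary := isUnitary_toHeckeCharacter L lam⁻¹
  have hn : n₁ = n₂ := by
    have hA : Fintype.card (Fin 1 × Fin 1) = Fintype.card (Fin n₁) := Fintype.card_congr eA
    have hB : Fintype.card (Fin 1 × Fin 1) = Fintype.card (Fin n₂) := Fintype.card_congr eB
    simp only [Fintype.card_prod, Fintype.card_fin] at hA hB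
    omega
  -- the middle reflection, the stabiliser lattice with a covering weight, the Haar measure `nB_* μ`
  obtain ⟨g₀, hg₀, -⟩ := exists_reflStd L e dV dW
  obtain ⟨Γ₀, β₁, hΓ₀, hβ₁⟩ := exists_stabilizer_coveringWeight L e dV hdV dW hdW
    (⟨iotaGG L e dV hdV dW hdW (1, UnitaryGroup.rationalPairToAdelic (Fp L) L (IsCMField.complexConj L) 2 1 (Matrix.diagonal dV) (Matrix.diagonal dW) g₀),
      iotaGG_one_mem_ratH L e dV hdV dW hdW g₀⟩ : ratH L e dV hdV dW hdW)
  haveI : (Measure.map nB μ).IsHaarMeasure := isHaarMeasure_map_lineChart L eA dA hdA dW hdW hdA0 hdW0 μ nB hnBc hnBadd hnB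
  -- ★ `…WhittakerLineInl`: ONE constant `C` BEFORE `γ, S'`
  have hmid := exists_middle_cell_rankOne_eq_whittakerDelta_line_inl eA eB dA hdA dB hdB hVA hVB
    (hg₀ := hg₀) (Λ := Λ) (hΛ := hΛ) (Γ₀ := Γ₀) (hΓ₀ := hΓ₀) (wq := wq) (hwq := hwq) hdV0 hdW0 he νN μ nB hnBc hnB
  obtain ⟨C, hC0, hCtop, hmain⟩ := hmid
  have hCr : C.toReal ≠ 0 := (ENNReal.toReal_pos hC0 hCtop).ne'
  -- the two Whittaker values as functions of `s`, holomorphic on the window (★ p863263 §2 along the first summand)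
  have hhol : ∀ (γ : Projectivization L (Fin 2 → L) → GL (Fin 2) L) (S' : Matrix (Fin 2) (Fin 2) L), DifferentiableOn ℂ (fun s : ℂ =>
      whittakerDelta L eA dA hdA dW hdW (Measure.map nB μ) ((Matrix.reindex (idxSplit e eA eB) (idxSplit e eA eB) S').toBlocks₁₁)
        (fun y => f s (blkD L e eA eB dA hdA dB hdB dV hdV hVA hVB dW hdW (y, 1) *
          (Λ (Matrix.GeneralLinearGroup.map (algebraMap L (AdeleRing (𝓞 L) L)) (γ (Projectivization.mk L w hw))) * x))) 1) {s : ℂ | 0 < s.re} :=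
    fun γ S' => differentiableOn_whittakerDelta_blkD_inl_line (N₁ := 1) (N₂ := 1) (M := 1) (n := 2) L e eA eB dA hdA dB hdB dV hdV hVA hVB dW hdW
      hdA0 hdW0 hn (𝒦 := 𝒦) (χ := toHeckeCharacter L lam⁻¹) (f := f) hχ hstd hcont
      (Λ (Matrix.GeneralLinearGroup.map (algebraMap L (AdeleRing (𝓞 L) L)) (γ (Projectivization.mk L w hw))) * x) (Measure.map nB μ)
      ((Matrix.reindex (idxSplit e eA eB) (idxSplit e eA eB) S').toBlocks₁₁) 1
  -- equality on `{1 < re s}` through the middle term, then on the window by the identity theorem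
  refine eq_of_eq_on_one_lt (hhol γ₁ S'₁) (hhol γ₂ S'₂) (fun t ht => ?_) hs
  have ht' : ((2 : ℕ) : ℝ) / 2 < t.re := by norm_num; exact ht
  have hH := lintegral_tsum_enorm_mul_weight_ne_top L e dV hdV dW hdW hdV0 hdW0 hχ ht' (hstd.1.1 t) (hcont t) νN hβtop hK hβK x
  have k₁ := hmain hβ₁ hβ (hstd.1.1 t) (hcont t) (fun g => measurePreserving_conj_levi Λ hΛ hdV0 hdW0 νN g) S.2 hS1 hu hw γ₁ hγ₁ S'₁ hψ₁ x hH
  have k₂ := hmain hβ₁ hβ (hstd.1.1 t) (hcont t) (fun g => measurePreserving_conj_levi Λ hΛ hdV0 hdW0 νN g) S.2 hS1 hu hw γ₂ hγ₂ S'₂ hψ₂ x hH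
  exact eq_of_real_smul_eq hCr (k₁.symm.trans k₂)

end Summit.HodgeConjecture.HodgeConjecture.Cruxes.HLiu418.K2LiuKindOneLineFrameIndependence

end
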